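import Summits.QuantumFields.BalabanUV.Beta.GAN24.T2DeviationTower
import Summits.QuantumFields.BalabanUV.Beta.SecondOrderTableLawEnd

/-!
# `BalabanUV.Beta.GAN24.T2DeviationTowerLiteral` — binder row G-an2-4 ∕ (CONV-C), CT-W route (R-DEV): **THE OWNER's (R-DEV) END AT ROAD FP's LITERAL OF RECORD**
# (centre root `ρ_c = toSite (ctrOff (3+1) Lc)`, pins `(cE, cVH, cΛ, cE₂, cB) = (Lc⁴, −Lc⁸∕2, 2∕Lc⁴, Lc⁸, −Lc¹²∕4)`, `Tc := (8N²)⁻¹ • wsym22 N`, an1's border `vh₂SAn1 Lc`, odd `Lc`)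
# — the four rows (U)(G′)(Z′)(F3ᴱ-irr) DISPLAYED at the literal data

NOT IN PRINT; OUR PROOF ATTEMPT (G-an2-4 formalisation swarm, leaf prover `b2b-balaban-gan24-formalise-leaf-04` gen 58, crux team (2); the OWNER gan24-p1 g23's WORD W9
[GAN24P1-G23-W2] `CLAIMS.log` l.38010 «leaf-04 FILES `GAN24/T2DeviationTowerLiteral.lean`»; names PROVISIONAL — the OWNER may rename ∕ re-cut).  HONEST FRAMING (cell contract,
verbatim): «discharging `BetaPertH` makes Bałaban's UV stability UNCONDITIONAL — a real constructive-QFT result; it is NOT the continuum limit and NOT the Clay problem.»  HONEST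
DEPENDENCY (verbatim): «continuum YM on T⁴ ⇐ BetaPertH ∧ nine spine estimates (0/9 proved); BetaPertH ⇐ (D1) ∧ (D4) ∧ CAP+tail; G-an2-4 gates asym, D1 and NE2/3/4.»
WHAT ([folklore] composition BY NAME; 0 `def`, 0 cited facts, 0 `def … : Prop`, 0 sorry): the OWNER's `T2DeviationTower.t2Shape_T2RecAt_of_dev_rows` at `d := 3`, the centre root
(`ctrOff_mem_box`), the pins, an1's border (off-diagonal by `vh₂SAn1_inl_inl` ∕ `vh₂SAn1_inr_inr`, `LocStencil₂` by K-P's `SecondOrderTableLawEnd.locStencil₂_vh₂SAn1` at odd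
`Lc`); the conclusion is LITERALLY the «T2Shape» binder `hT₂` of gan24-p2's capstone `WrecAtSlotRowsFinal.exists_allScalesSeq_JsRowD1Pin_of_T2` (p311334 ✓).  §1
**`t2Shape_literal_of_dev_rows`** — rows (U) «T2Shape» of the undressed-kernel comb-slot tower, (G′) `LocStencil₂` of the deviation forcing `g′_m`, (Z′) `Zfree (g′_m)` (abstract
`Zfree`, `mom`: at d = 3 road W3's currency is `ZfreeSym`, any `mom`), (F3ᴱ-irr) irrelevance of the DRESSED composite transport on `Zfree` tables — ALL DISPLAYED at the literal
data ((G′)(Z′) and the `mom` row BUNDLED into one binder `hgrow` over a β-redex so the forcing `g′_m` is displayed ONCE — elaboration budget).  Row (U)'s own supplier (this lineage's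
`T2RecSourceRowsUndressed` ∕ `T2UndressedCombShapeEnd`, (U) ⟸ F2a-comb) plugs into `hT` by application when F2a-comb's fate is settled (P-leaf02-g52-2).  Discharges NOTHING of «T2Shape»(E) ∕ «T2Drift» ∕ (hW, hWall) unconditionally;
NOT «W-slot closed», NOT «D1 closed»; NEVER «G-an2-4 closed» as (CONV-C); NOT D1, NOT `BetaPertH`, NOT continuum, NOT Clay; not in print — our bookkeeping.  2026-08-22.
-/

noncomputable section

open Finset
open scoped BigOperators
open Literature.MathematicalPhysics.QuantumFieldTheory
open Literature.MathematicalPhysics.QuantumFieldTheory.Balaban1983to89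
open Literature.MathematicalPhysics.QuantumFieldTheory.Balaban1983to89.Beta
open ExpKernelCalculus (MKer shiftK)
open OneStepResolventKernel (Fib LocStencil)
open OneStepKernelFamily (KInvStep)
open AffineAveraging (box toSite)
open AveragingContoursRooted (ctrOff ctrOff_mem_box)
open AveragingMixedJetTables (mixFFAt)
open WilsonVertex2Sym (wsym22)
open SecondOrderResponse (W2SymOfK)
open BalabanCompositeJets (LocStencil₂)
open BalabanStepJetsSucc (mmRead)
open BalabanStepW2 (K3OfK M2Of)
open Summit.QuantumFields.BalabanUV.Beta.HessKerDressedUnits (unitK unitS)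
open Summit.QuantumFields.BalabanUV.Beta.SecondOrderUnits (unitM unitS₂ unitM₂)
open Summit.QuantumFields.BalabanUV.Beta.AxialDressingRooted (coDressKBmAt)
open Summit.QuantumFields.BalabanUV.Beta.SpineRooted (T2RecOf T2RecAt SpureRecAt M1At)
open Summit.QuantumFields.BalabanUV.Beta.SecondOrderSocketIdentification (vh₂SAn1 vh₂SAn1_inl_inl vh₂SAn1_inr_inr)
open Summit.QuantumFields.BalabanUV.Beta.SecondOrderTableLawEnd (locStencil₂_vh₂SAn1)
open Summit.QuantumFields.BalabanUV.Beta.GAN24.CombesThomas (sfStep smStep)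
open Summit.QuantumFields.BalabanUV.Beta.GAN24.T2RecursionAffine (lin4)
open Summit.QuantumFields.BalabanUV.Beta.GAN24.AffineUnroll (transport)
open Summit.QuantumFields.BalabanUV.Beta.GAN24.Push4Iter (BiTab)
open Summit.QuantumFields.BalabanUV.Beta.GAN24.T2DeviationTower (t2Shape_T2RecAt_of_dev_rows)

namespace Summit.QuantumFields.BalabanUV.Beta.GAN24.T2DeviationTowerLiteral

variable {Lc : ℕ} [NeZero Lc]

/-! ## §1 The (R-DEV) END at the literal's data, the four rows displayed -/

/-- NOT IN PRINT; OUR PROOF ATTEMPT ([folklore] specialisation of the OWNER's `T2DeviationTower.t2Shape_T2RecAt_of_dev_rows`).  **«T2Shape» OF an2's COMB T₂ TOWER AT THE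
LITERAL OF RECORD ⟸ (U) ∧ (G′) ∧ (Z′) ∧ (F3ᴱ-irr) at the literal's data** (odd `Lc ≥ 2`, colour `N`, abstract `Zfree`∕`mom`).  The conclusion is the `hT₂` binder of
`WrecAtSlotRowsFinal.exists_allScalesSeq_JsRowD1Pin_of_T2` token for token. -/
theorem t2Shape_literal_of_dev_rows (hodd : Odd Lc) (hLc : 2 ≤ Lc) (N : ℕ) (Zfree : BiTab 3 → Prop) (mom : BiTab 3 → ℝ)
    {C₂ δ₂ Cg δg CE ρ δE : ℝ} (hCE : 0 ≤ CE) (hρ0 : 0 ≤ ρ) (hρ1 : ρ < 1)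
    (hT : ∀ n, LocStencil₂ (unitS₂ (sfStep Lc n) (smStep 3 Lc n) (T2RecOf 3 Lc (fun j => KInvStep (d := 3) Lc j) (SpureRecAt 3 Lc (toSite (ctrOff (3 + 1) Lc)) ((Lc : ℝ) ^ 4) (-((Lc : ℝ) ^ 8 / 2)) (2 / (Lc : ℝ) ^ 4)) (M1At 3 Lc (toSite (ctrOff (3 + 1) Lc)) (2 / (Lc : ℝ) ^ 4)) ((Lc : ℝ) ^ 8) (-((Lc : ℝ) ^ 12 / 4)) ((8 * (N : ℝ) ^ 2)⁻¹ • wsym22 N) (vh₂SAn1 Lc) (mixFFAt (toSite (ctrOff (3 + 1) Lc)) Lc) n)) C₂ δ₂) (hδ₂ : 0 < δ₂)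
    (hgrow : ∀ m : ℕ, (fun X : BiTab 3 => LocStencil₂ X Cg δg ∧ Zfree X ∧ mom X ≤ Cg)
      (((lin4 ((Lc : ℝ) ^ 8 * (Lc : ℝ) ^ (2 * (3 + 1))) (unitK (sfStep Lc m) (smStep 3 Lc m) (coDressKBmAt (toSite (ctrOff (3 + 1) Lc)) Lc (KInvStep (d := 3) Lc m))) Lc
            (unitS₂ (sfStep Lc m) (smStep 3 Lc m) (T2RecOf 3 Lc (fun j => KInvStep (d := 3) Lc j) (SpureRecAt 3 Lc (toSite (ctrOff (3 + 1) Lc)) ((Lc : ℝ) ^ 4) (-((Lc : ℝ) ^ 8 / 2)) (2 / (Lc : ℝ) ^ 4)) (M1At 3 Lc (toSite (ctrOff (3 + 1) Lc)) (2 / (Lc : ℝ) ^ 4)) ((Lc : ℝ) ^ 8) (-((Lc : ℝ) ^ 12 / 4)) ((8 * (N : ℝ) ^ 2)⁻¹ • wsym22 N) (vh₂SAn1 Lc) (mixFFAt (toSite (ctrOff (3 + 1) Lc)) Lc) m)) -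
          lin4 ((Lc : ℝ) ^ 8 * (Lc : ℝ) ^ (2 * (3 + 1))) (unitK (sfStep Lc m) (smStep 3 Lc m) (KInvStep (d := 3) Lc m)) Lc
            (unitS₂ (sfStep Lc m) (smStep 3 Lc m) (T2RecOf 3 Lc (fun j => KInvStep (d := 3) Lc j) (SpureRecAt 3 Lc (toSite (ctrOff (3 + 1) Lc)) ((Lc : ℝ) ^ 4) (-((Lc : ℝ) ^ 8 / 2)) (2 / (Lc : ℝ) ^ 4)) (M1At 3 Lc (toSite (ctrOff (3 + 1) Lc)) (2 / (Lc : ℝ) ^ 4)) ((Lc : ℝ) ^ 8) (-((Lc : ℝ) ^ 12 / 4)) ((8 * (N : ℝ) ^ 2)⁻¹ • wsym22 N) (vh₂SAn1 Lc) (mixFFAt (toSite (ctrOff (3 + 1) Lc)) Lc) m))) +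
        ((fun κ u κ' u' => ((Lc : ℝ) ^ 8 * (Lc : ℝ) ^ (2 * (3 + 1))) • mmRead Lc (K3OfK (unitK (sfStep Lc m) (smStep 3 Lc m) (coDressKBmAt (toSite (ctrOff (3 + 1) Lc)) Lc (KInvStep (d := 3) Lc m))) Lc
            (unitS (sfStep Lc m) (smStep 3 Lc m) (SpureRecAt 3 Lc (toSite (ctrOff (3 + 1) Lc)) ((Lc : ℝ) ^ 4) (-((Lc : ℝ) ^ 8 / 2)) (2 / (Lc : ℝ) ^ 4) m)) (unitM (sfStep Lc m) (smStep 3 Lc m) (M1At 3 Lc (toSite (ctrOff (3 + 1) Lc)) (2 / (Lc : ℝ) ^ 4) m))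
            (W2SymOfK (unitK (sfStep Lc m) (smStep 3 Lc m) (coDressKBmAt (toSite (ctrOff (3 + 1) Lc)) Lc (KInvStep (d := 3) Lc m))) Lc (unitS (sfStep Lc m) (smStep 3 Lc m) (SpureRecAt 3 Lc (toSite (ctrOff (3 + 1) Lc)) ((Lc : ℝ) ^ 4) (-((Lc : ℝ) ^ 8 / 2)) (2 / (Lc : ℝ) ^ 4) m))
              (unitM (sfStep Lc m) (smStep 3 Lc m) (M1At 3 Lc (toSite (ctrOff (3 + 1) Lc)) (2 / (Lc : ℝ) ^ 4) m)) 0 (unitM₂ (sfStep Lc m) (smStep 3 Lc m) (M2Of 3 Lc (mixFFAt (toSite (ctrOff (3 + 1) Lc)) Lc) m))) κ u κ' u')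
          + (-((Lc : ℝ) ^ 12 / 4)) • vh₂SAn1 Lc κ u κ' u') -
         (fun κ u κ' u' => ((Lc : ℝ) ^ 8 * (Lc : ℝ) ^ (2 * (3 + 1))) • mmRead Lc (K3OfK (unitK (sfStep Lc m) (smStep 3 Lc m) (KInvStep (d := 3) Lc m)) Lc
            (unitS (sfStep Lc m) (smStep 3 Lc m) (SpureRecAt 3 Lc (toSite (ctrOff (3 + 1) Lc)) ((Lc : ℝ) ^ 4) (-((Lc : ℝ) ^ 8 / 2)) (2 / (Lc : ℝ) ^ 4) m)) (unitM (sfStep Lc m) (smStep 3 Lc m) (M1At 3 Lc (toSite (ctrOff (3 + 1) Lc)) (2 / (Lc : ℝ) ^ 4) m))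
            (W2SymOfK (unitK (sfStep Lc m) (smStep 3 Lc m) (KInvStep (d := 3) Lc m)) Lc (unitS (sfStep Lc m) (smStep 3 Lc m) (SpureRecAt 3 Lc (toSite (ctrOff (3 + 1) Lc)) ((Lc : ℝ) ^ 4) (-((Lc : ℝ) ^ 8 / 2)) (2 / (Lc : ℝ) ^ 4) m))
              (unitM (sfStep Lc m) (smStep 3 Lc m) (M1At 3 Lc (toSite (ctrOff (3 + 1) Lc)) (2 / (Lc : ℝ) ^ 4) m)) 0 (unitM₂ (sfStep Lc m) (smStep 3 Lc m) (M2Of 3 Lc (mixFFAt (toSite (ctrOff (3 + 1) Lc)) Lc) m))) κ u κ' u')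
          + (-((Lc : ℝ) ^ 12 / 4)) • vh₂SAn1 Lc κ u κ' u')))))
    (hTirrE : ∀ (m k : ℕ) (X : BiTab 3) (C : ℝ), 0 ≤ C → LocStencil₂ X C δg → Zfree X → mom X ≤ C →
      LocStencil₂ (transport (fun j => lin4 ((Lc : ℝ) ^ 8 * (Lc : ℝ) ^ (2 * (3 + 1))) (unitK (sfStep Lc j) (smStep 3 Lc j) (coDressKBmAt (toSite (ctrOff (3 + 1) Lc)) Lc (KInvStep (d := 3) Lc j))) Lc) m k X) (CE * C * ρ ^ k) δE) (hδE : 0 < δE) :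
    ∃ C₂' δ₂' : ℝ, 0 < δ₂' ∧ ∀ n, LocStencil₂ (unitS₂ (sfStep Lc n) (smStep 3 Lc n) (T2RecAt 3 Lc (toSite (ctrOff (3 + 1) Lc)) ((Lc : ℝ) ^ 4) (-((Lc : ℝ) ^ 8 / 2)) (2 / (Lc : ℝ) ^ 4) ((Lc : ℝ) ^ 8) (-((Lc : ℝ) ^ 12 / 4)) ((8 * (N : ℝ) ^ 2)⁻¹ • wsym22 N) (vh₂SAn1 Lc) (mixFFAt (toSite (ctrOff (3 + 1) Lc)) Lc) n)) C₂' δ₂' :=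
  t2Shape_T2RecAt_of_dev_rows (d := 3) (by omega) (ctrOff_mem_box (by omega)) ((Lc : ℝ) ^ 4) (-((Lc : ℝ) ^ 8 / 2)) (2 / (Lc : ℝ) ^ 4)
    ((Lc : ℝ) ^ 8) (-((Lc : ℝ) ^ 12 / 4)) ((8 * (N : ℝ) ^ 2)⁻¹ • wsym22 N)
    (fun κ u κ' u' x z α β => vh₂SAn1_inl_inl κ u κ' u' x z α β) (fun κ u κ' u' x z μ ν => vh₂SAn1_inr_inr κ u κ' u' x z μ ν)
    (locStencil₂_vh₂SAn1 hodd) Zfree mom hCE hρ0 hρ1 hT hδ₂ (fun m => (hgrow m).1) (fun m => (hgrow m).2.1) (fun m => (hgrow m).2.2) hTirrE hδE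

end Summit.QuantumFields.BalabanUV.Beta.GAN24.T2DeviationTowerLiteral

end
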